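import Literature.Analysis.FluidPDE.ParabolicHeatPotentials
import HarnessLib

/-!
# Lemma 13.6 of Lemarié-Rieusset 2016 from Prop. 13.4 and the localised Duhamel formula

Analysis/FluidPDE file in the decomposition of the named fact
`Literature.Analysis.FluidPDE.LemarieRieusset2016.lemma13_6` (`CKNMorreyLemmas.lean`:
Lemarié-Rieusset 2016, Lemma 13.6 p. 477, the last step of the parabolic-Morrey proof of the
Caffarelli–Kohn–Nirenberg criterion, Thm. 13.8): under the standing hypotheses of §13.9 and the
Morrey bounds `1_{Q₂} f ∈ ℳ₂^{10/7,τ₀}`, `1_{Q₂} u ∈ ℳ₂^{3,τ₂} ∩ ℳ₂^{3,σ}`, `1_{Q₂} ∇ ⊗ u ∈ ℳ₂^{2,τ₃}`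
on `Q₂ = Q_{r₂}(t₀, x₀)`, the velocity is Hölderian on every `Q_{r₃}(t₀, x₀)`, `r₃ < r₂`.

The printed proof (pp. 477–478, with Step 3, (13.50)–(13.52), pp. 474–475) localises:
`v = φu` (`φ ∈ 𝒟`, `φ = 1` on `Q₃`, `supp φ ⊆ Q₂`) solves, on `ℝ × ℝ³`,
`∂ₜv = νΔv + g + ∑ᵢ ∂ᵢhᵢ - γ - η - ∑ⱼₗ ∇∂ⱼ∂ₗG * (φ uⱼuₗ)` ((13.50)–(13.51): `g = A₁ + A₂`,
`A₁ = (∂ₜφ)u + ν(Δφ)u + φf`, `A₂ = -φ u·∇u`, `hᵢ = -2ν(∂ᵢφ)u`, `γ` the far-field Newton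
potentials of `(Δζ)p`, `(∂ⱼ∂ₗζ)uⱼuₗ`, …, `η = -∑ⱼₗ [φ, ∇∂ⱼ∂ₗΔ⁻¹](ζuⱼuₗ)`), lists the parabolic
Morrey classes of these data (p. 478: `A₁ ∈ ℳ₂^{10/7, min(τ₀,τ₂)}`, `A₂ ∈ ℳ₂^{6/5,ρ}` with
`1/ρ = 1/τ₂ + 1/5 + 1/σ < 2/5`, `hᵢ ∈ ℳ₂^{3,τ₂}`, `γ ∈ L^{q₀}_t L^∞_x ⊂ ℳ₂^{q₀,5q₀/2}`,
`η ∈ ℳ₂^{3/2,ρ}` by Calderón's commutator theorem, `φuⱼuₗ ∈ ℳ₂^{3/2,ρ'}` with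
`1/ρ' = 1/τ₂ + 1/σ < 1/5`), "and we apply Proposition 13.4" — i.e. `v`, which vanishes near
`t = t₀ - r₂²`, is the Duhamel integral `∫_{t₀-r₂²}^t W_{ν(t-s)} * (…) ds` of these data, a finite
sum of the two kinds of heat potentials of Prop. 13.4 (`∫ W_{ν(t-s)} * F(s) ds` with
`F ∈ ℳ₂^{p,q}`, `5/2 < q < 5`, and `∫ W_{ν(t-s)} * σ(D)g(s) ds` with `g ∈ ℳ₂^{p,q}`, `q > 5`, `σ`
smooth off `0` and homogeneous of degree `1`), each parabolic-Hölder by Prop. 13.4.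

This file splits the printed proof at exactly that sentence:

* `LemarieRieusset2016.IsHeatDatum T p q F`, `LemarieRieusset2016.IsMultiplierDatum T p q σ g` —
  the hypotheses of the two one-datum instances of Prop. 13.4 (`prop13_4.heatPotential_holder`,
  `prop13_4.multiplierHeatPotential_holder`, `ParabolicHeatPotentials.lean`): Morrey class,
  measurability, vanishing for `s ≤ T`, and (for `σ`) smoothness off `0` and homogeneity;
* `LemarieRieusset2016.lemma13_6_duhamel` — **named fact** (Step 3 and the proof of Lemma 13.6
  minus Prop. 13.4): under the hypotheses of Lemma 13.6, for every `0 < r₃ < r₂` and every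
  component `k`, `uₖ` agrees a.e. on `Q₃ = Q_{r₃}(t₀, x₀)` with (the real part of) a finite sum of
  heat potentials `heatPotential ν Fᵢ`, `multiplierHeatPotential ν σⱼ gⱼ` of such data with time
  origin `T = t₀ - r₂²`, plus a function `R` which is Lipschitz for the parabolic distance on `Q₃`;
* `LemarieRieusset2016.representation_holder` — **proved**: given Prop. 13.4, every such sum is
  parabolic-Hölder on `Q₃` of some exponent `α ∈ (0, 1)` (Prop. 13.4 termwise, then the minimum
  exponent on the bounded cylinder);
* `LemarieRieusset2016.lemma13_6_of_duhamel : prop13_4 → lemma13_6_duhamel → lemma13_6` —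
  **proved** assembly (`ℝ³` from components, a.e. equality).

## Design notes (the shape of `lemma13_6_duhamel`)

* The data are recorded **by their Prop. 13.4 classes only** (finite families, each datum with its
  own exponents `p, q`), not by the explicit formulas of (13.50)–(13.51): those involve the Newton
  potential and the Calderón commutator `[φ, ∇∂ⱼ∂ₗΔ⁻¹]` on `L^{3/2}`, which have no Lean rendering,
  and Step 4 uses nothing about the data beyond their classes and the representation. The printed
  data are an instance (`A₁ ∈ ℳ₂^{10/7,min(τ₀,τ₂,4)}` after lowering the exponent on the bounded
  support, `A₂, γ, η` of `f`-type, `hᵢ ∈ ℳ₂^{3,τ₂} ⊆ ℳ₂^{5/2,τ₂}` and `φuⱼuₗ` of `σ(D)g`-type with the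
  symbols `2πiξᵢ` of `∂ᵢ` and `2πi ξₖξⱼξₗ/|ξ|²` of `∂ₖ∂ⱼ∂ₗΔ⁻¹`), with `R = 0`.
* The Lipschitz term `R`. The printed (13.51) localises the *pressure* (`ζp = G * Δ(ζp)`, exact
  Newtonian kernel) and pays with Calderón's commutator theorem for `η` (p. 476). The same
  localisation can be written with a *truncated* Newtonian kernel `N = χG` instead (this is how
  the tree proves the representation behind Lemma 13.5, by duality: `CKNMorreyDualIdentity.lean`,
  `CKNMorreyDualEstimate.lean`, and how Seregin–Šverák 2009 §2 is rendered,
  `NSBoundedInteriorRegularityProofs.lean`): then no commutator appears, the principal term is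
  again `(∂ₖ∂ⱼ∂ₗΔ⁻¹ W₊) ⊛ (φuⱼuₗ)` plus an `f`-type potential of bounded data, while the terms
  carrying a derivative of the cut-off against the pressure — the analogue of the printed `γ` —
  become potentials `∫ K(z - w) d(w) dw` of merely integrable data `d = (∂φ)p, (Δφ)p, …`
  (`p ∈ L^{q₀}_{t,x}` only: Lemma 13.6 carries no Morrey bound on the pressure) supported in the
  shell where `∇φ ≠ 0`, at positive distance from `Q₃`; there the kernels (`W₊`, `W₊ *ₓ ∂ₖN`,
  `∂ᵢW₊ *ₓ ∂ₖN`) are bounded with bounded derivatives, so these terms are Lipschitz on `Q₃` for the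
  parabolic distance, though not globally in a class covered by Prop. 13.4. The statement therefore
  allows, besides the Prop. 13.4 potentials, one parabolic-Lipschitz term `R` on `Q₃`. This makes
  `lemma13_6_duhamel` weaker than what pp. 474–478 print (the case `R = 0`), never stronger, and it
  is exactly what the last sentence of the printed proof consumes (`lemma13_6_of_duhamel`). It is
  not a rewording of Lemma 13.6: a Hölder representative of `u` is not a Lipschitz `R`.
* Morrey data are `IsParabolicMorreyOn univ (‖F ·‖ₑ) p q` plus `Measurable F`, as in `prop13_4`; the
  time origin `t₀ - r₂²` of the Duhamel integral is handled by the translation corollaries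
  `prop13_4.heatPotential_holder`, `prop13_4.multiplierHeatPotential_holder`; the potentials are the
  accepted `ℂ`-valued `heatPotential` / `multiplierHeatPotential` (`ParabolicHeatPotentials.lean`), of
  which the real part is taken (their kernels are real: `multiplierHeatKernel_derivSymbol_im`,
  `multiplierHeatKernel_oseenSymbol_im`, `HeatKernelMultiplierDerivatives.lean`).
* The `ν`-factors missing in the printed (13.50) (`(Δφ)u`, `-2(∂ᵢφ)u`; compare (13.23), p. 466)
  are immaterial here.

## References

* P. G. Lemarié-Rieusset, *The Navier–Stokes Problem in the 21st Century*, CRC Press (2016),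
  §13.8 Prop. 13.4 (p. 464); §13.9 Step 3, (13.50)–(13.52) (pp. 474–475); Step 4, Lemma 13.6 and
  its proof (pp. 477–478). [LemarieRieusset2016]
* A. P. Calderón, *Commutators of singular integral operators*, Proc. Nat. Acad. Sci. USA 53
  (1965), 1092–1099 (the commutator theorem invoked on p. 476).
* G. Seregin, V. Šverák, *On Type I singularities of the local axi-symmetric solutions of the
  Navier–Stokes equations*, Comm. PDE 34 (2009), §2 (the kernel-localised duality mechanism).
  [SereginSverak2009]
-/

noncomputable section

open MeasureTheory Set Function Filter Metric TopologicalSpace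
open scoped NNReal ENNReal

namespace Literature.Analysis.FluidPDE

/-- Local notation for physical space `ℝ³ = EuclideanSpace ℝ (Fin 3)`. -/
local notation "ℝ³" => EuclideanSpace ℝ (Fin 3)

namespace LemarieRieusset2016

/-! ### The two kinds of data of Prop. 13.4 -/

/-- **An `f`-type datum of Prop. 13.4 with time origin `T`** (Lemarié-Rieusset 2016, Prop. 13.4,
p. 464, the datum `f ∈ ℳ₂^{p,q₀}`, `1 ≤ p ≤ q₀`, `1/q₀ = 2/5 - α/5` with `0 < α < 1`, i.e.
`5/2 < q₀ < 5`): `F : ℝ × ℝ³ → ℝ` is measurable, vanishes for `s ≤ T`, and `F ∈ ℳ₂^{p,q}` on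
`ℝ × ℝ³` with `1 ≤ p ≤ q`, `5/2 < q < 5` — exactly the hypotheses of
`prop13_4.heatPotential_holder`, under which `heatPotential ν F = ∫_T^t W_{ν(t-s)} * F(s) ds` is
parabolic-Hölder of exponent `2 - 5/q`. [cite: LemarieRieusset2016, Prop. 13.4 p. 464] -/
structure IsHeatDatum (T p q : ℝ) (F : ℝ × ℝ³ → ℝ) : Prop where
  /-- `1 ≤ p`. -/
  one_le : 1 ≤ p
  /-- `p ≤ q`. -/
  p_le : p ≤ q
  /-- `5/2 < q` … -/
  lower : 5 / 2 < q
  /-- … `< 5`. -/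
  upper : q < 5
  /-- The datum is measurable … -/
  measurable : Measurable F
  /-- … vanishes before the time origin … -/
  eq_zero : ∀ w : ℝ × ℝ³, w.1 ≤ T → F w = 0
  /-- … and belongs to `ℳ₂^{p,q}`. -/
  morrey : IsParabolicMorreyOn univ (fun w => ‖F w‖ₑ) p q

/-- **A `σ(D)g`-type datum of Prop. 13.4 with time origin `T`** (Lemarié-Rieusset 2016,
Prop. 13.4, p. 464, the datum `g ∈ ℳ₂^{p,q₁}`, `1/q₁ = 1/5 - α/5`, `p ≤ q₀ = 5q₁/(q₁ + 5)`, and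
"`σ` a smooth function on `ℝ³ ∖ {0}`, homogeneous of exponent `1`"): `g : ℝ × ℝ³ → ℝ` is
measurable, vanishes for `s ≤ T`, `g ∈ ℳ₂^{p,q}` on `ℝ × ℝ³` with `q > 5`, `1 ≤ p ≤ 5q/(q+5)`, and
the symbol `σ : ℝ³ → ℂ` is smooth off the origin and homogeneous of degree `1` — exactly the
hypotheses of `prop13_4.multiplierHeatPotential_holder`, under which
`multiplierHeatPotential ν σ g = ∫_T^t W_{ν(t-s)} * σ(D)g(s) ds` is parabolic-Hölder of exponent
`1 - 5/q`. [cite: LemarieRieusset2016, Prop. 13.4 p. 464] -/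
structure IsMultiplierDatum (T p q : ℝ) (σ : ℝ³ → ℂ) (g : ℝ × ℝ³ → ℝ) : Prop where
  /-- `1 ≤ p`. -/
  one_le : 1 ≤ p
  /-- `p ≤ 5q/(q + 5)` (the companion exponent `q₀` of Prop. 13.4). -/
  p_le : p ≤ 5 * q / (q + 5)
  /-- `q > 5`. -/
  lower : 5 < q
  /-- The symbol is smooth off the origin … -/
  contDiffOn : ContDiffOn ℝ ((⊤ : ℕ∞) : WithTop ℕ∞) σ {0}ᶜ
  /-- … and homogeneous of degree `1`. -/
  smul : ∀ c : ℝ, 0 < c → ∀ ξ : ℝ³, σ (c • ξ) = (c : ℂ) * σ ξ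
  /-- The datum is measurable … -/
  measurable : Measurable g
  /-- … vanishes before the time origin … -/
  eq_zero : ∀ w : ℝ × ℝ³, w.1 ≤ T → g w = 0
  /-- … and belongs to `ℳ₂^{p,q}`. -/
  morrey : IsParabolicMorreyOn univ (fun w => ‖g w‖ₑ) p q

/-- Prop. 13.4 for an `f`-type datum: its heat potential is parabolic-Hölder of exponent
`2 - 5/q ∈ (0, 1)` on `ℝ × ℝ³` (the corollary `prop13_4.heatPotential_holder`). [cite: LemarieRieusset2016, Prop. 13.4 p. 464] -/
theorem IsHeatDatum.holder {T p q : ℝ} {F : ℝ × ℝ³ → ℝ} (hF : IsHeatDatum T p q F)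
    (h4 : prop13_4) {ν : ℝ} (hν : 0 < ν) :
    0 < 2 - 5 / q ∧ 2 - 5 / q < 1 ∧
      ∃ C : ℝ, ParabolicHolderOnWith C (2 - 5 / q) (heatPotential ν fun w => (F w : ℂ)) univ := by
  have hq0 : 0 < q := by linarith [hF.lower]
  refine ⟨?_, ?_, h4.heatPotential_holder hν hF.one_le hF.p_le hF.lower hF.upper hF.measurable
    hF.eq_zero hF.morrey⟩
  · have : 5 / q < 2 := by rw [div_lt_iff₀ hq0]; linarith [hF.lower]
    linarith
  · have : 1 < 5 / q := by rw [lt_div_iff₀ hq0]; linarith [hF.upper]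
    linarith

/-- Prop. 13.4 for a `σ(D)g`-type datum: its multiplier heat potential is parabolic-Hölder of
exponent `1 - 5/q ∈ (0, 1)` on `ℝ × ℝ³` (the corollary `prop13_4.multiplierHeatPotential_holder`). [cite: LemarieRieusset2016, Prop. 13.4 p. 464] -/
theorem IsMultiplierDatum.holder {T p q : ℝ} {σ : ℝ³ → ℂ} {g : ℝ × ℝ³ → ℝ}
    (hg : IsMultiplierDatum T p q σ g) (h4 : prop13_4) {ν : ℝ} (hν : 0 < ν) :
    0 < 1 - 5 / q ∧ 1 - 5 / q < 1 ∧
      ∃ C : ℝ, ParabolicHolderOnWith C (1 - 5 / q) (multiplierHeatPotential ν σ g) univ := by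
  have hq0 : 0 < q := by linarith [hg.lower]
  refine ⟨?_, ?_, h4.multiplierHeatPotential_holder hν hg.one_le hg.p_le hg.lower hg.contDiffOn
    hg.smul hg.measurable hg.eq_zero hg.morrey⟩
  · have : 5 / q < 1 := by rw [div_lt_iff₀ hq0]; linarith [hg.lower]
    linarith
  · have : 0 < 5 / q := by positivity
    linarith

/-! ### The named fact: Step 3 and the proof of Lemma 13.6 up to Prop. 13.4 -/

/-- **The localised Duhamel representation behind Lemma 13.6** (Lemarié-Rieusset 2016, §13.9,
Step 3, (13.50)–(13.52), pp. 474–475, and the proof of Lemma 13.6, pp. 477–478, up to its last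
sentence "and we apply Proposition 13.4"). Let `ν > 0` and let `u` be a suitable solution of the
Navier–Stokes equations on the domain `Ω` in the sense of §13.9 (`IsSuitableOn`:
`f ∈ L^{10/7}_{t,x}(Ω)`, `p ∈ L^{q₀}_{t,x}(Ω)`, `1 < q₀ ≤ 3/2`). Assume that on some neighbourhood
`Q₂ = Q_{r₂}(t₀, x₀) ⊆ Ω`: `1_{Q₂} f ∈ ℳ₂^{10/7,τ₀}` for some `τ₀ > 5/2`; `1_{Q₂} u ∈ ℳ₂^{3,τ₂}`
for some `τ₂ > 5`; `1_{Q₂} u ∈ ℳ₂^{3,σ}` with `1/σ + 1/τ₂ < 1/5`; `1_{Q₂} ∇ ⊗ u ∈ ℳ₂^{2,τ₃}`,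
`1/τ₃ = 1/τ₂ + 1/5`. Let `0 < r₃ < r₂`, `Q₃ = Q_{r₃}(t₀, x₀)`. In print: with `φ ∈ 𝒟(ℝ × ℝ³)`
equal to `1` on `Q₃` and supported in `Q₂`, `v = φu` solves
`∂ₜv = νΔv + g + ∑ᵢ∂ᵢhᵢ - γ - η - ∑ⱼₗ∇∂ⱼ∂ₗG * (φuⱼuₗ)` ((13.50)–(13.51)) with
`(∂ₜφ)u + (Δφ)u + φf ∈ ℳ₂^{10/7,min(τ₀,τ₂)}`, `φu·∇u ∈ ℳ₂^{6/5,ρ}` (`1/ρ = 1/τ₂ + 1/5 + 1/σ < 2/5`),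
`hᵢ = -2(∂ᵢφ)u ∈ ℳ₂^{3,τ₂}`, `γ ∈ ℳ^{q₀,5q₀/2}`, `η ∈ ℳ₂^{3/2,ρ}`, `φuⱼuₗ ∈ ℳ₂^{3/2,ρ'}`
(`1/ρ' = 1/τ₂ + 1/σ < 1/5`) (p. 478), and `v`, which vanishes before `t₀ - r₂²`, is the Duhamel
integral of these data from that time: on `Q₃`, `u = v` is a finite sum of the two kinds of heat
potentials of Prop. 13.4. Rendered (see the module docstring for the shape): for every component
`k` there are finitely many `f`-type data `Fᵢ ∈ ℳ₂^{pᵢ,qᵢ}` (`1 ≤ pᵢ ≤ qᵢ`, `5/2 < qᵢ < 5`) and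
`σ(D)g`-type data `gⱼ ∈ ℳ₂^{pⱼ,qⱼ}` (`qⱼ > 5`, `pⱼ ≤ 5qⱼ/(qⱼ + 5)`, symbols `σⱼ` smooth off `0`
and homogeneous of degree `1`), all measurable and vanishing for `s ≤ t₀ - r₂²`, and a function
`R` Lipschitz on `Q₃` for the parabolic distance (the cut-off pressure terms of the
kernel-localised form of (13.51); `R = 0` for the printed data), such that for a.e. `z ∈ Q₃`,
`uₖ(z) = Re (∑ᵢ ∫ W₊(z - w) Fᵢ(w) dw + ∑ⱼ ∫ (σⱼ(D)W₊)(z - w) gⱼ(w) dw) + R(z)`. [cite: LemarieRieusset2016, §13.9 Step 3 (13.50)–(13.52) pp. 474–475; Lemma 13.6 proof pp. 477–478] -/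
def lemma13_6_duhamel : Prop :=
  ∀ (ν q₀ τ₀ τ₂ σ : ℝ) (Ω : Opens (ℝ × ℝ³)) (f u : ℝ → ℝ³ → ℝ³) (p : ℝ → ℝ³ → ℝ)
    (G : ℝ → ℝ³ → ℝ³ →L[ℝ] ℝ³) (z₀ : ℝ × ℝ³) (r₂ : ℝ),
    0 < ν → 1 < q₀ → q₀ ≤ 3 / 2 → 5 / 2 < τ₀ → 5 < τ₂ → 0 < σ → 1 / σ + 1 / τ₂ < 1 / 5 →
    0 < r₂ →
    IsSuitableOn Ω ν q₀ f u p G →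
    FluidPDE.parabolicCylinderCentered r₂ z₀ ⊆ (Ω : Set (ℝ × ℝ³)) →
    IsParabolicMorreyOn (FluidPDE.parabolicCylinderCentered r₂ z₀)
      (fun w => ‖f w.1 w.2‖ₑ) (10 / 7) τ₀ →
    IsParabolicMorreyOn (FluidPDE.parabolicCylinderCentered r₂ z₀) (fun w => ‖u w.1 w.2‖ₑ) 3 τ₂ →
    IsParabolicMorreyOn (FluidPDE.parabolicCylinderCentered r₂ z₀) (fun w => ‖u w.1 w.2‖ₑ) 3 σ →
    IsParabolicMorreyOn (FluidPDE.parabolicCylinderCentered r₂ z₀)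
      (gradENorm G) 2 (τ₂⁻¹ + 5⁻¹)⁻¹ →
    ∀ r₃ : ℝ, 0 < r₃ → r₃ < r₂ → ∀ k : Fin 3,
      ∃ (n₁ n₂ : ℕ) (F : Fin n₁ → ℝ × ℝ³ → ℝ) (p₁ q₁ : Fin n₁ → ℝ)
        (m : Fin n₂ → ℝ³ → ℂ) (g : Fin n₂ → ℝ × ℝ³ → ℝ) (p₂ q₂ : Fin n₂ → ℝ)
        (R : ℝ × ℝ³ → ℝ) (L : ℝ),
        (∀ i, IsHeatDatum (z₀.1 - r₂ ^ 2) (p₁ i) (q₁ i) (F i)) ∧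
        (∀ j, IsMultiplierDatum (z₀.1 - r₂ ^ 2) (p₂ j) (q₂ j) (m j) (g j)) ∧
        ParabolicHolderOnWith L 1 R (FluidPDE.parabolicCylinderCentered r₃ z₀) ∧
        ∀ᵐ z ∂(volume.restrict (FluidPDE.parabolicCylinderCentered r₃ z₀)),
          (u z.1 z.2) k =
            (∑ i, heatPotential ν (fun w => ((F i w : ℝ) : ℂ)) z
              + ∑ j, multiplierHeatPotential ν (m j) (g j) z).re + R z

/-! ### Hölder continuity of the represented function (the use of Prop. 13.4) -/

/-- Two finite families of positive reals have a common lower bound in `(0, 1)`. [folklore] -/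
theorem exists_common_exponent {n₁ n₂ : ℕ} {a : Fin n₁ → ℝ} {b : Fin n₂ → ℝ}
    (ha : ∀ i, 0 < a i) (hb : ∀ j, 0 < b j) :
    ∃ β : ℝ, 0 < β ∧ β < 1 ∧ (∀ i, β ≤ a i) ∧ ∀ j, β ≤ b j := by
  classical
  have hne : (insert (1 / 2 : ℝ) (Finset.univ.image a ∪ Finset.univ.image b)).Nonempty :=
    ⟨1 / 2, Finset.mem_insert_self _ _⟩
  refine ⟨(insert (1 / 2 : ℝ) (Finset.univ.image a ∪ Finset.univ.image b)).min' hne, ?_, ?_,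
    fun i => ?_, fun j => ?_⟩
  · have hmem := Finset.min'_mem _ hne
    rcases Finset.mem_insert.1 hmem with h | h
    · rw [h]; norm_num
    · rcases Finset.mem_union.1 h with h' | h'
      · obtain ⟨i, -, hi⟩ := Finset.mem_image.1 h'
        rw [← hi]; exact ha i
      · obtain ⟨j, -, hj⟩ := Finset.mem_image.1 h'
        rw [← hj]; exact hb j
  · have : (insert (1 / 2 : ℝ) (Finset.univ.image a ∪ Finset.univ.image b)).min' hne ≤ 1 / 2 :=
      Finset.min'_le _ _ (Finset.mem_insert_self _ _)
    linarith
  · exact Finset.min'_le _ _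
      (Finset.mem_insert_of_mem (Finset.mem_union_left _ (Finset.mem_image_of_mem a (by simp))))
  · exact Finset.min'_le _ _
      (Finset.mem_insert_of_mem (Finset.mem_union_right _ (Finset.mem_image_of_mem b (by simp))))

/-- Lowering a global Hölder bound of exponent `β ≥ α > 0` (or a bound on the cylinder itself)
to exponent `α` on the bounded cylinder `Q_{r₃}(z₀)` (parabolic diameter `≤ 4r₃`). [folklore] -/
theorem holder_lower {F' : Type*} [NormedAddCommGroup F'] {h : ℝ × ℝ³ → F'} {C α β r₃ : ℝ}
    {z₀ : ℝ × ℝ³} {S : Set (ℝ × ℝ³)} (hr₃ : 0 < r₃) (hh : ParabolicHolderOnWith C β h S)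
    (hS : FluidPDE.parabolicCylinderCentered r₃ z₀ ⊆ S) (hα : 0 < α) (hαβ : α ≤ β) :
    ∃ C', ParabolicHolderOnWith C' α h (FluidPDE.parabolicCylinderCentered r₃ z₀) :=
  ⟨max C 0 * (4 * r₃) ^ (β - α),
    (hh.max_const_zero.mono hS).of_exponent_le (le_max_right _ _) hα hαβ
      fun _ h₁ _ h₂ => parabolicDist_le_of_mem_cylinder hr₃ h₁ h₂⟩

/-- **Hölder continuity of the localised Duhamel representation** (the content of "and we apply
Proposition 13.4", Lemarié-Rieusset 2016, p. 478). Given Prop. 13.4, a finite sum of heat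
potentials of `f`-type data and multiplier heat potentials of `σ(D)g`-type data (real part), plus
a function Lipschitz for the parabolic distance on `Q_{r₃}(z₀)`, is parabolic-Hölder on
`Q_{r₃}(z₀)` of some exponent `α ∈ (0, 1)`: Prop. 13.4 gives the exponents `2 - 5/qᵢ`, `1 - 5/qⱼ`
on `ℝ × ℝ³` termwise, and on the bounded cylinder every term is Hölder of the minimum exponent. [cite: LemarieRieusset2016, Lemma 13.6 proof p. 478] -/
theorem representation_holder (h4 : prop13_4) {ν T r₃ L : ℝ} {z₀ : ℝ × ℝ³} (hν : 0 < ν)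
    (hr₃ : 0 < r₃) {n₁ n₂ : ℕ} {F : Fin n₁ → ℝ × ℝ³ → ℝ} {p₁ q₁ : Fin n₁ → ℝ}
    {m : Fin n₂ → ℝ³ → ℂ} {g : Fin n₂ → ℝ × ℝ³ → ℝ} {p₂ q₂ : Fin n₂ → ℝ} {R : ℝ × ℝ³ → ℝ}
    (hF : ∀ i, IsHeatDatum T (p₁ i) (q₁ i) (F i))
    (hg : ∀ j, IsMultiplierDatum T (p₂ j) (q₂ j) (m j) (g j))
    (hR : ParabolicHolderOnWith L 1 R (FluidPDE.parabolicCylinderCentered r₃ z₀)) :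
    ∃ α C : ℝ, 0 < α ∧ α < 1 ∧
      ParabolicHolderOnWith C α
        (fun z => (∑ i, heatPotential ν (fun w => ((F i w : ℝ) : ℂ)) z
          + ∑ j, multiplierHeatPotential ν (m j) (g j) z).re + R z)
        (FluidPDE.parabolicCylinderCentered r₃ z₀) := by
  set S : Set (ℝ × ℝ³) := FluidPDE.parabolicCylinderCentered r₃ z₀ with hS
  -- the common exponent
  obtain ⟨α, hα0, hα1, hαF, hαg⟩ := exists_common_exponent (fun i => ((hF i).holder h4 hν).1)
    (fun j => ((hg j).holder h4 hν).1)
  -- the `f`-type terms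
  have hF' : ∀ i, ∃ C, ParabolicHolderOnWith C α
      (heatPotential ν fun w => ((F i w : ℝ) : ℂ)) S := fun i => by
    obtain ⟨C, hC⟩ := ((hF i).holder h4 hν).2.2
    exact holder_lower hr₃ hC (subset_univ _) hα0 (hαF i)
  -- the `σ(D)g`-type terms
  have hg' : ∀ j, ∃ C, ParabolicHolderOnWith C α (multiplierHeatPotential ν (m j) (g j)) S :=
    fun j => by
    obtain ⟨C, hC⟩ := ((hg j).holder h4 hν).2.2
    exact holder_lower hr₃ hC (subset_univ _) hα0 (hαg j)
  -- the Lipschitz term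
  obtain ⟨C₃, h₃⟩ : ∃ C, ParabolicHolderOnWith C α R S :=
    holder_lower hr₃ hR Subset.rfl hα0 hα1.le
  choose C₁ h₁ using hF'
  choose C₂ h₂ using hg'
  have h₁s := ParabolicHolderOnWith.sum (s := Finset.univ) fun i _ => h₁ i
  have h₂s := ParabolicHolderOnWith.sum (s := Finset.univ) fun j _ => h₂ j
  exact ⟨α, _, hα0, hα1, (h₁s.add h₂s).re.add h₃⟩

/-! ### Assembly of Lemma 13.6 -/

/-- **Lemma 13.6 from Prop. 13.4 and the localised Duhamel representation** (Lemarié-Rieusset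
2016, proof of Lemma 13.6, pp. 477–478: "We write again (13.50) … and we apply Proposition
13.4"). Given `prop13_4` and `lemma13_6_duhamel`, Lemma 13.6 holds: on `Q_{r₃}(t₀, x₀)` each
component of the velocity agrees a.e. with a parabolic-Hölder function
(`representation_holder`), hence `u` agrees a.e. with an `ℝ³`-valued field which is
parabolic-Hölder of the minimum of the three exponents. [cite: LemarieRieusset2016, Lemma 13.6 pp. 477–478] -/
theorem lemma13_6_of_duhamel (h4 : prop13_4) (hD : lemma13_6_duhamel) : lemma13_6 := by
  intro ν q₀ τ₀ τ₂ σ Ω f u p G z₀ r₂ hν hq₀ hq₀' hτ₀ hτ₂ hσ hστ hr₂ hS hQΩ hMf hMu hMuσ hMG r₃ hr₃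
    hr₃₂
  set S : Set (ℝ × ℝ³) := FluidPDE.parabolicCylinderCentered r₃ z₀ with hSdef
  -- a Hölder function agreeing with each component a.e. on `Q₃`
  have hk : ∀ k : Fin 3, ∃ (w : ℝ × ℝ³ → ℝ) (β C : ℝ), 0 < β ∧ β < 1 ∧
      ParabolicHolderOnWith C β w S ∧
      ∀ᵐ z ∂(volume.restrict S), (u z.1 z.2) k = w z := by
    intro k
    obtain ⟨n₁, n₂, F, p₁, q₁, m, g, p₂, q₂, R, L, hF, hg, hR, hae⟩ :=
      hD ν q₀ τ₀ τ₂ σ Ω f u p G z₀ r₂ hν hq₀ hq₀' hτ₀ hτ₂ hσ hστ hr₂ hS hQΩ hMf hMu hMuσ hMG r₃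
        hr₃ hr₃₂ k
    obtain ⟨β, C, hβ0, hβ1, hH⟩ := representation_holder h4 hν hr₃ hF hg hR
    exact ⟨_, β, C, hβ0, hβ1, hH, hae⟩
  choose w β C hβ0 hβ1 hH hae using hk
  -- the common exponent of the three components
  set α : ℝ := min (β 0) (min (β 1) (β 2)) with hα
  have hα0 : 0 < α := lt_min (hβ0 0) (lt_min (hβ0 1) (hβ0 2))
  have hα1 : α < 1 := (min_le_left _ _).trans_lt (hβ1 0)
  have hαle : ∀ k, α ≤ β k := fun k => by
    fin_cases k
    · exact min_le_left _ _
    · exact (min_le_right _ _).trans (min_le_left _ _)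
    · exact (min_le_right _ _).trans (min_le_right _ _)
  have hH' : ∀ k, ∃ C', ParabolicHolderOnWith C' α (w k) S := fun k =>
    holder_lower hr₃ (hH k) Subset.rfl hα0 (hαle k)
  choose Cs hCs using hH'
  refine ⟨fun z => WithLp.toLp 2 fun k => w k z, ∑ k, Cs k, α, hα0, hα1, ?_, ?_⟩
  · rw [isParabolicHolderOn_iff]
    exact ParabolicHolderOnWith.euclidean fun k => by simpa using hCs k
  · have hall : ∀ᵐ z ∂(volume.restrict S), ∀ k, (u z.1 z.2) k = w k z := ae_all_iff.2 hae
    filter_upwards [hall] with z hz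
    ext k
    simpa [uncurry] using hz k

end LemarieRieusset2016

end Literature.Analysis.FluidPDE
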